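import Summits.CriticalPhenomena.SAWScalingLimit.Theorems.SAWDefectDecoherenceBoundaryClosureRLatticeArms
import Summits.CriticalPhenomena.SAWScalingLimit.Theorems.SAWDefectDecoherenceBoundaryClosureRBoundaryExactness
import HarnessLib

/-!
# Boundary data transfer, I: exact lattice identities in the `b`-frame

Route `SAWDefectDecoherence`, crux `BoundaryClosureR` (stmt-CriticalPhenomena-14004), line
`pick-half-plane`, stub `stub_boundaryDataTransfer` (r11 stub 5c): the hypotheses (I1)–(I4) of the
landed `pickEngine_stage2` for the locally uniform limit `h` of the normalised developing maps
`h_δ(s) = δ (H s − H s_b)/F(b δ)`.  This file collects the EXACT finite-lattice identities that are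
passed to the limit in the sibling files (setting: `Λ` simply connected, floor ROOT
`a = floorEdge ka mr`, floor NORMALISER `b = floorEdge kb m' ≠ a` reached by `γ_b : a → b` of
winding `W_b`, `H` a potential, `Z = ‖F_{x_c,0}‖`):

* `flatSegment_step` / `flatSegment_sum` — on a flat floor segment NOT containing the root the
  eastward steps of `H` are `(√3/6)·i·e^{i(3/8)W₀}·Z_k`, ONE phase `W₀` for the whole segment
  ((E2) phase law + (E3) straight gate); `flatSegment_frame`: in the `b`-frame the increments are
  `−i e^{i(3/8)(W₀−W_b)}·(√3/6)·Σ Z/Z_b`, and `flatSegment_norm`: their norm is `(√3/6) Σ Z/Z_b`;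
* `east_arm_diff` / `west_arm_diff` / `east_arm_norm` — the root's own arms (landed `lattice_arms`)
  rewritten with the engine's phase `θ = π/8 − (3/8)W_b` (`e^{iθ_arms} = −e^{iθ}`);
* `rootFrame_re` / `rootFrame_wedge` — `Re(conj ω · h_δ(s)) = −δ(Re H s − Re H s_b)/Z_b` for
  `ω = −e^{i(5/8)W_b}` (`conj ω / F(b) = −1/Z_b` exactly), so `HalfPlaneBounds` IS the wedge
  `−M ≤ Re(conj ω · h_δ)`;
* `exists_winding_eq` — `e^{iW} = −1 ⇒ W = π + 2πj`; `phase_eq_of_class` etc. — classes mod 8.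
-/

noncomputable section

open scoped BigOperators ComplexConjugate
open Complex (I exp)
open Literature.Probability.LatticeModels Literature.Probability.RandomPlanarGeometry
open Literature.Probability.RandomPlanarGeometry.SAW
open Summit.CriticalPhenomena.SAWScalingLimit.Theorems.PickHalfPlane.BoundaryExactness

namespace Summit.CriticalPhenomena.SAWScalingLimit.Theorems.PickHalfPlane.BoundaryDataTransfer

variable {Λ : Finset HexVertex}

/-! ### Flat segments away from the root -/

/-- **One step on a flat segment not containing the floor root.**  For a floor root
`floorEdge ka mr`, a flat floor `k₁ … k₂` of row `m` none of whose darts is the root, and a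
reference dart `k₀` of the segment reached by `γ₀`, every eastward step of a potential along the
segment is `(√3/6)·i·e^{i(3/8)W(γ₀)}·Z(floorEdge k m)` (phase law (E2), straight gate (E3); a dart
reached by no walk has `F = Z = 0`). [folklore] -/
theorem flatSegment_step (hΛ : hexDomainSimplyConnected Λ) {ka mr m k₁ k₂ : ℤ}
    (hUa : upFace ka mr ∈ Λ) (hBa : belowFace ka mr ∉ Λ)
    (hF : ∀ k : ℤ, k₁ ≤ k → k ≤ k₂ → ((![k, m], 0) : HexVertex) ∈ Λ ∧
      ((![k, m - 1], 1) : HexVertex) ∉ Λ ∧ (k < k₂ → ((![k, m], 1) : HexVertex) ∈ Λ))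
    (hroot : ∀ k : ℤ, k₁ ≤ k → k ≤ k₂ → floorEdge k m ≠ floorEdge ka mr)
    {k₀ : ℤ} (hk₀₁ : k₁ ≤ k₀) (hk₀₂ : k₀ ≤ k₂)
    (γ₀ : HexMidEdgeSAW Λ (floorEdge ka mr) (floorEdge k₀ m))
    {H : Site 2 → ℂ} (hH : IsPotential Λ (floorEdge ka mr) H) {k : ℤ} (hk₁ : k₁ ≤ k) (hk₂ : k ≤ k₂) :
    H ![k + 1, m] - H ![k, m] = ((Real.sqrt 3 / 6 : ℝ) : ℂ) * I *
      exp (I * (3 / 8 : ℂ) * (γ₀.winding : ℂ)) *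
      (‖hexParafermionicObservable Λ (floorEdge ka mr) hexCriticalFugacity 0 (floorEdge k m)‖ : ℂ) := by
  rw [potential_floor_step hH (hF k hk₁ hk₂).1, hexMidpoint_floorEdge_sub]
  by_cases hne : Nonempty (HexMidEdgeSAW Λ (floorEdge ka mr) (floorEdge k m))
  · obtain ⟨γ⟩ := hne
    have hW : γ.winding = γ₀.winding :=
      straightGate Λ hΛ (belowFace ka mr) (upFace ka mr) (adj_belowFace_upFace ka mr) hBa hUa m k₁ k₂
        hF hroot k₀ k hk₀₁ hk₀₂ hk₁ hk₂ γ₀ γ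
    rw [floorDart_observable_eq hΛ hUa hBa (hF k hk₁ hk₂).1 (hF k hk₁ hk₂).2.1 (hroot k hk₁ hk₂) γ,
      hW]
    have e : ((1 : ℂ) - 2 * triZeta) / 6 = -((2 * triZeta - 1) / 3 / 2) := by ring
    rw [e, floorDir_eq]
    ring
  · rw [not_nonempty_iff] at hne
    simp [hexParafermionicObservable]

/-- **The flat segment law** (telescoped `flatSegment_step`): for `k₁ ≤ k`, `k + n ≤ k₂ + 1`,
`H(k+n, m) − H(k, m) = (√3/6)·i·e^{i(3/8)W(γ₀)}·Σ_{i<n} Z(floorEdge (k+i) m)`. [folklore] -/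
theorem flatSegment_sum (hΛ : hexDomainSimplyConnected Λ) {ka mr m k₁ k₂ : ℤ}
    (hUa : upFace ka mr ∈ Λ) (hBa : belowFace ka mr ∉ Λ)
    (hF : ∀ k : ℤ, k₁ ≤ k → k ≤ k₂ → ((![k, m], 0) : HexVertex) ∈ Λ ∧
      ((![k, m - 1], 1) : HexVertex) ∉ Λ ∧ (k < k₂ → ((![k, m], 1) : HexVertex) ∈ Λ))
    (hroot : ∀ k : ℤ, k₁ ≤ k → k ≤ k₂ → floorEdge k m ≠ floorEdge ka mr)
    {k₀ : ℤ} (hk₀₁ : k₁ ≤ k₀) (hk₀₂ : k₀ ≤ k₂)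
    (γ₀ : HexMidEdgeSAW Λ (floorEdge ka mr) (floorEdge k₀ m))
    {H : Site 2 → ℂ} (hH : IsPotential Λ (floorEdge ka mr) H) :
    ∀ (n : ℕ) (k : ℤ), k₁ ≤ k → k + n ≤ k₂ + 1 →
      H ![k + n, m] - H ![k, m] = ((Real.sqrt 3 / 6 : ℝ) : ℂ) * I *
        exp (I * (3 / 8 : ℂ) * (γ₀.winding : ℂ)) *
        ((∑ i ∈ Finset.range n, ‖hexParafermionicObservable Λ (floorEdge ka mr) hexCriticalFugacity 0
          (floorEdge (k + i) m)‖ : ℝ) : ℂ) := by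
  intro n
  induction n with
  | zero => intro k _ _; simp
  | succ n ih =>
    intro k hk hkn
    have hsplit : H ![k + ((n + 1 : ℕ) : ℤ), m] - H ![k, m] =
        (H ![k + (n : ℤ) + 1, m] - H ![k + (n : ℤ), m]) + (H ![k + (n : ℤ), m] - H ![k, m]) := by
      push_cast; ring_nf
    rw [hsplit, ih k hk (by push_cast at hkn; omega),
      flatSegment_step hΛ hUa hBa hF hroot hk₀₁ hk₀₂ γ₀ hH (k := k + n) (by omega)
        (by push_cast at hkn; omega),
      Finset.sum_range_succ]
    push_cast
    ring

/-- **The flat segment law in the `b`-frame**: with the normaliser `b = floorEdge kb m' ≠ a` reached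
by `γ_b`, `(H(k+n, m) − H(k, m))/F(b) = −i·e^{i(3/8)(W(γ₀) − W_b)}·(√3/6)·Σ_{i<n} Z/Z_b`
(`F(b) = −e^{i(3/8)W_b} Z_b`). [folklore] -/
theorem flatSegment_frame (hΛ : hexDomainSimplyConnected Λ) {ka mr m k₁ k₂ : ℤ}
    (hUa : upFace ka mr ∈ Λ) (hBa : belowFace ka mr ∉ Λ)
    (hF : ∀ k : ℤ, k₁ ≤ k → k ≤ k₂ → ((![k, m], 0) : HexVertex) ∈ Λ ∧
      ((![k, m - 1], 1) : HexVertex) ∉ Λ ∧ (k < k₂ → ((![k, m], 1) : HexVertex) ∈ Λ))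
    (hroot : ∀ k : ℤ, k₁ ≤ k → k ≤ k₂ → floorEdge k m ≠ floorEdge ka mr)
    {k₀ : ℤ} (hk₀₁ : k₁ ≤ k₀) (hk₀₂ : k₀ ≤ k₂)
    (γ₀ : HexMidEdgeSAW Λ (floorEdge ka mr) (floorEdge k₀ m))
    {kb m' : ℤ} (hUb : upFace kb m' ∈ Λ) (hBb : belowFace kb m' ∉ Λ)
    (hneb : floorEdge kb m' ≠ floorEdge ka mr) (γb : HexMidEdgeSAW Λ (floorEdge ka mr) (floorEdge kb m'))
    {H : Site 2 → ℂ} (hH : IsPotential Λ (floorEdge ka mr) H) :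
    ∀ (n : ℕ) (k : ℤ), k₁ ≤ k → k + n ≤ k₂ + 1 →
      (H ![k + n, m] - H ![k, m]) /
          hexParafermionicObservable Λ (floorEdge ka mr) hexCriticalFugacity (5 / 8) (floorEdge kb m') =
        -(I * exp (I * (3 / 8 : ℂ) * ((γ₀.winding - γb.winding : ℝ) : ℂ))) *
          ((Real.sqrt 3 / 6 * ∑ i ∈ Finset.range n,
            ‖hexParafermionicObservable Λ (floorEdge ka mr) hexCriticalFugacity 0 (floorEdge (k + i) m)‖ /
              ‖hexParafermionicObservable Λ (floorEdge ka mr) hexCriticalFugacity 0 (floorEdge kb m')‖ :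
              ℝ) : ℂ) := by
  intro n k hk hkn
  obtain ⟨hFb, hZb⟩ := normaliser_observable hΛ hUa hBa hUb hBb hneb γb
  rw [flatSegment_sum hΛ hUa hBa hF hroot hk₀₁ hk₀₂ γ₀ hH n k hk hkn, hFb, ← Finset.sum_div]
  have hZb0 : ((‖hexParafermionicObservable Λ (floorEdge ka mr) hexCriticalFugacity 0
      (floorEdge kb m')‖ : ℝ) : ℂ) ≠ 0 := Complex.ofReal_ne_zero.2 hZb.ne'
  have hE0 : exp (I * (3 / 8 : ℂ) * (γb.winding : ℂ)) ≠ 0 := Complex.exp_ne_zero _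
  have hE : exp (I * (3 / 8 : ℂ) * ((γ₀.winding - γb.winding : ℝ) : ℂ)) *
      exp (I * (3 / 8 : ℂ) * (γb.winding : ℂ)) = exp (I * (3 / 8 : ℂ) * (γ₀.winding : ℂ)) := by
    rw [← Complex.exp_add]
    congr 1
    push_cast
    ring
  rw [← hE]
  push_cast
  field_simp

/-- **Norm of the flat segment increments in the `b`-frame**: `(√3/6)·Σ_{i<n} Z/Z_b` (the phase is
unimodular). [folklore] -/
theorem flatSegment_norm (hΛ : hexDomainSimplyConnected Λ) {ka mr m k₁ k₂ : ℤ}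
    (hUa : upFace ka mr ∈ Λ) (hBa : belowFace ka mr ∉ Λ)
    (hF : ∀ k : ℤ, k₁ ≤ k → k ≤ k₂ → ((![k, m], 0) : HexVertex) ∈ Λ ∧
      ((![k, m - 1], 1) : HexVertex) ∉ Λ ∧ (k < k₂ → ((![k, m], 1) : HexVertex) ∈ Λ))
    (hroot : ∀ k : ℤ, k₁ ≤ k → k ≤ k₂ → floorEdge k m ≠ floorEdge ka mr)
    {k₀ : ℤ} (hk₀₁ : k₁ ≤ k₀) (hk₀₂ : k₀ ≤ k₂)
    (γ₀ : HexMidEdgeSAW Λ (floorEdge ka mr) (floorEdge k₀ m))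
    {kb m' : ℤ} (hUb : upFace kb m' ∈ Λ) (hBb : belowFace kb m' ∉ Λ)
    (hneb : floorEdge kb m' ≠ floorEdge ka mr) (γb : HexMidEdgeSAW Λ (floorEdge ka mr) (floorEdge kb m'))
    {H : Site 2 → ℂ} (hH : IsPotential Λ (floorEdge ka mr) H) :
    ∀ (n : ℕ) (k : ℤ), k₁ ≤ k → k + n ≤ k₂ + 1 →
      ‖(H ![k + n, m] - H ![k, m]) /
          hexParafermionicObservable Λ (floorEdge ka mr) hexCriticalFugacity (5 / 8) (floorEdge kb m')‖ =
        Real.sqrt 3 / 6 * ∑ i ∈ Finset.range n,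
            ‖hexParafermionicObservable Λ (floorEdge ka mr) hexCriticalFugacity 0 (floorEdge (k + i) m)‖ /
              ‖hexParafermionicObservable Λ (floorEdge ka mr) hexCriticalFugacity 0 (floorEdge kb m')‖ := by
  intro n k hk hkn
  rw [flatSegment_frame hΛ hUa hBa hF hroot hk₀₁ hk₀₂ γ₀ hUb hBb hneb γb hH n k hk hkn, norm_mul, norm_neg,
    norm_mul, Complex.norm_I, one_mul,
    show I * (3 / 8 : ℂ) * ((γ₀.winding - γb.winding : ℝ) : ℂ) =
      ((3 / 8 * (γ₀.winding - γb.winding) : ℝ) : ℂ) * I by push_cast; ring,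
    Complex.norm_exp_ofReal_mul_I, one_mul, Complex.norm_real, Real.norm_of_nonneg]
  have hZb := (normaliser_observable hΛ hUa hBa hUb hBb hneb γb).2
  exact mul_nonneg (by positivity)
    (Finset.sum_nonneg fun i _ => div_nonneg (norm_nonneg _) hZb.le)

/-! ### The root's own arms with the engine phase `θ = π/8 − (3/8)W_b` -/

/-- The arm phase of `lattice_arms` versus the engine phase: `e^{i(−(3/8)W − 7π/8)} = −e^{i(π/8 − (3/8)W)}`.
[folklore] -/
theorem exp_armPhase_eq (W : ℝ) :
    exp (I * ((-(3 / 8 * W) - 7 / 8 * Real.pi : ℝ) : ℂ)) =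
      -exp (((Real.pi / 8 - 3 / 8 * W : ℝ) : ℂ) * I) := by
  have e : I * ((-(3 / 8 * W) - 7 / 8 * Real.pi : ℝ) : ℂ) =
      ((Real.pi / 8 - 3 / 8 * W : ℝ) : ℂ) * I + -(Real.pi * I) := by
    push_cast; ring
  rw [e, Complex.exp_add, Complex.exp_neg, Complex.exp_pi_mul_I]
  ring

/-- **East arm differences lie on the line of direction `e^{iθ}`**, `θ = π/8 − (3/8)W_b`: for two
sites `ka+1+n`, `ka+1+n'` east of the root,
`(H(ka+1+n) − H(ka+1+n'))/F(b) = e^{iθ}·s` with the explicit real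
`s = −(√3/6)(Σ_{i<n} − Σ_{i<n'}) Z_{ka+1+i}/Z_b`. [folklore] -/
theorem east_arm_diff (hΛ : hexDomainSimplyConnected Λ) {mr k₁ k₂ ka : ℤ}
    (hF : ∀ k : ℤ, k₁ ≤ k → k ≤ k₂ → ((![k, mr], 0) : HexVertex) ∈ Λ ∧
      ((![k, mr - 1], 1) : HexVertex) ∉ Λ ∧ (k < k₂ → ((![k, mr], 1) : HexVertex) ∈ Λ))
    (hka₁ : k₁ ≤ ka) (hka₂ : ka ≤ k₂) {kb m' : ℤ} (hUb : upFace kb m' ∈ Λ) (hBb : belowFace kb m' ∉ Λ)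
    (hneb : floorEdge kb m' ≠ floorEdge ka mr) (γb : HexMidEdgeSAW Λ (floorEdge ka mr) (floorEdge kb m'))
    {H : Site 2 → ℂ} (hH : IsPotential Λ (floorEdge ka mr) H)
    (n n' : ℕ) (hn : ka + 1 + n ≤ k₂ + 1) (hn' : ka + 1 + n' ≤ k₂ + 1) :
    (H ![ka + 1 + n, mr] - H ![ka + 1 + n', mr]) /
        hexParafermionicObservable Λ (floorEdge ka mr) hexCriticalFugacity (5 / 8) (floorEdge kb m') =
      exp (((Real.pi / 8 - 3 / 8 * γb.winding : ℝ) : ℂ) * I) *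
        ((-(Real.sqrt 3 / 6 * ((∑ i ∈ Finset.range n,
            ‖hexParafermionicObservable Λ (floorEdge ka mr) hexCriticalFugacity 0
                (floorEdge (ka + 1 + i) mr)‖) - ∑ i ∈ Finset.range n',
            ‖hexParafermionicObservable Λ (floorEdge ka mr) hexCriticalFugacity 0
                (floorEdge (ka + 1 + i) mr)‖) /
              ‖hexParafermionicObservable Λ (floorEdge ka mr) hexCriticalFugacity 0 (floorEdge kb m')‖) :
            ℝ) : ℂ) := by
  have hE := (lattice_arms hΛ hF hka₁ hka₂ hUb hBb hneb γb hH).1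
  have hsplit : H ![ka + 1 + n, mr] - H ![ka + 1 + n', mr] =
      (H ![ka + 1 + n, mr] - H ![ka + 1, mr]) - (H ![ka + 1 + n', mr] - H ![ka + 1, mr]) := by ring
  rw [hsplit, sub_div, hE n hn, hE n' hn', exp_armPhase_eq]
  simp only [← Finset.sum_div]
  push_cast
  ring

/-- **West arm differences lie on the line of direction `e^{i(θ − π/4)}`**: for two sites `ka−n`,
`ka−n'` west of (or at) the root column,
`(H(ka−n) − H(ka−n'))/F(b) = e^{i(θ−π/4)}·s` with an explicit real `s`. [folklore] -/
theorem west_arm_diff (hΛ : hexDomainSimplyConnected Λ) {mr k₁ k₂ ka : ℤ}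
    (hF : ∀ k : ℤ, k₁ ≤ k → k ≤ k₂ → ((![k, mr], 0) : HexVertex) ∈ Λ ∧
      ((![k, mr - 1], 1) : HexVertex) ∉ Λ ∧ (k < k₂ → ((![k, mr], 1) : HexVertex) ∈ Λ))
    (hka₁ : k₁ ≤ ka) (hka₂ : ka ≤ k₂) {kb m' : ℤ} (hUb : upFace kb m' ∈ Λ) (hBb : belowFace kb m' ∉ Λ)
    (hneb : floorEdge kb m' ≠ floorEdge ka mr) (γb : HexMidEdgeSAW Λ (floorEdge ka mr) (floorEdge kb m'))
    {H : Site 2 → ℂ} (hH : IsPotential Λ (floorEdge ka mr) H)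
    (n n' : ℕ) (hn : k₁ ≤ ka - n) (hn' : k₁ ≤ ka - n') :
    (H ![ka - n, mr] - H ![ka - n', mr]) /
        hexParafermionicObservable Λ (floorEdge ka mr) hexCriticalFugacity (5 / 8) (floorEdge kb m') =
      exp (((Real.pi / 8 - 3 / 8 * γb.winding - Real.pi / 4 : ℝ) : ℂ) * I) *
        ((-(Real.sqrt 3 / 6 * ((∑ i ∈ Finset.range n,
            ‖hexParafermionicObservable Λ (floorEdge ka mr) hexCriticalFugacity 0
                (floorEdge (ka - 1 - i) mr)‖) - ∑ i ∈ Finset.range n',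
            ‖hexParafermionicObservable Λ (floorEdge ka mr) hexCriticalFugacity 0
                (floorEdge (ka - 1 - i) mr)‖) /
              ‖hexParafermionicObservable Λ (floorEdge ka mr) hexCriticalFugacity 0 (floorEdge kb m')‖) :
            ℝ) : ℂ) := by
  have hW := (lattice_arms hΛ hF hka₁ hka₂ hUb hBb hneb γb hH).2
  have hsplit : H ![ka - n, mr] - H ![ka - n', mr] =
      (H ![ka - n, mr] - H ![ka, mr]) - (H ![ka - n', mr] - H ![ka, mr]) := by ring
  have hphase : exp (I * ((-(3 / 8 * γb.winding) - 7 / 8 * Real.pi - Real.pi / 4 : ℝ) : ℂ)) =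
      -exp (((Real.pi / 8 - 3 / 8 * γb.winding - Real.pi / 4 : ℝ) : ℂ) * I) := by
    have e : I * ((-(3 / 8 * γb.winding) - 7 / 8 * Real.pi - Real.pi / 4 : ℝ) : ℂ) =
        ((Real.pi / 8 - 3 / 8 * γb.winding - Real.pi / 4 : ℝ) : ℂ) * I + -(Real.pi * I) := by
      push_cast; ring
    rw [e, Complex.exp_add, Complex.exp_neg, Complex.exp_pi_mul_I]
    ring
  rw [hsplit, sub_div, hW n hn, hW n' hn', hphase]
  simp only [← Finset.sum_div]
  push_cast
  ring

/-- **Norm of east arm differences**: for `n' ≤ n`,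
`‖(H(ka+1+n) − H(ka+1+n'))/F(b)‖ = (√3/6)·Σ_{n' ≤ i < n} Z_{ka+1+i}/Z_b`. [folklore] -/
theorem east_arm_norm (hΛ : hexDomainSimplyConnected Λ) {mr k₁ k₂ ka : ℤ}
    (hF : ∀ k : ℤ, k₁ ≤ k → k ≤ k₂ → ((![k, mr], 0) : HexVertex) ∈ Λ ∧
      ((![k, mr - 1], 1) : HexVertex) ∉ Λ ∧ (k < k₂ → ((![k, mr], 1) : HexVertex) ∈ Λ))
    (hka₁ : k₁ ≤ ka) (hka₂ : ka ≤ k₂) {kb m' : ℤ} (hUb : upFace kb m' ∈ Λ) (hBb : belowFace kb m' ∉ Λ)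
    (hneb : floorEdge kb m' ≠ floorEdge ka mr) (γb : HexMidEdgeSAW Λ (floorEdge ka mr) (floorEdge kb m'))
    {H : Site 2 → ℂ} (hH : IsPotential Λ (floorEdge ka mr) H)
    (n n' : ℕ) (hn'n : n' ≤ n) (hn : ka + 1 + n ≤ k₂ + 1) :
    ‖(H ![ka + 1 + n, mr] - H ![ka + 1 + n', mr]) /
        hexParafermionicObservable Λ (floorEdge ka mr) hexCriticalFugacity (5 / 8) (floorEdge kb m')‖ =
      Real.sqrt 3 / 6 * (∑ i ∈ Finset.Ico n' n,
            ‖hexParafermionicObservable Λ (floorEdge ka mr) hexCriticalFugacity 0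
                (floorEdge (ka + 1 + i) mr)‖) /
          ‖hexParafermionicObservable Λ (floorEdge ka mr) hexCriticalFugacity 0 (floorEdge kb m')‖ := by
  have hn' : ka + 1 + n' ≤ k₂ + 1 := by
    have : (n' : ℤ) ≤ n := by exact_mod_cast hn'n
    omega
  rw [east_arm_diff hΛ hF hka₁ hka₂ hUb hBb hneb γb hH n n' hn hn', norm_mul,
    Complex.norm_exp_ofReal_mul_I, one_mul, Complex.norm_real, ← Finset.sum_range_add_sum_Ico _ hn'n,
    add_sub_cancel_left, Real.norm_eq_abs, abs_neg, abs_of_nonneg]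
  have hZb := (normaliser_observable hΛ (hF ka hka₁ hka₂).1 (hF ka hka₁ hka₂).2.1 hUb hBb hneb γb).2
  exact div_nonneg (mul_nonneg (by positivity) (Finset.sum_nonneg fun i _ => norm_nonneg _)) hZb.le

/-! ### The root frame: `HalfPlaneBounds` is the wedge -/

/-- **The root-frame identity**: for `ω = −e^{i(5/8)W_b}`, `conj ω / F(b) = −1/Z_b`, hence
`Re(conj ω · δ(H s − H s_b)/F(b)) = −δ·(Re H s − Re H s_b)/Z_b`. [folklore] -/
theorem rootFrame_re (hΛ : hexDomainSimplyConnected Λ) {ka mr kb m' : ℤ}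
    (hUa : upFace ka mr ∈ Λ) (hBa : belowFace ka mr ∉ Λ) (hUb : upFace kb m' ∈ Λ)
    (hBb : belowFace kb m' ∉ Λ) (hneb : floorEdge kb m' ≠ floorEdge ka mr)
    (γb : HexMidEdgeSAW Λ (floorEdge ka mr) (floorEdge kb m')) (H : Site 2 → ℂ) (s sb : Site 2) (δ : ℝ) :
    ((starRingEnd ℂ) (-exp (I * (5 / 8 : ℂ) * (γb.winding : ℂ))) *
        ((δ : ℂ) * (H s - H sb) /
          hexParafermionicObservable Λ (floorEdge ka mr) hexCriticalFugacity (5 / 8) (floorEdge kb m'))).re =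
      -(δ * ((H s).re - (H sb).re) /
        ‖hexParafermionicObservable Λ (floorEdge ka mr) hexCriticalFugacity 0 (floorEdge kb m')‖) := by
  obtain ⟨hFb, hZb⟩ := normaliser_observable hΛ hUa hBa hUb hBb hneb γb
  have hW := exp_winding_floorDarts hBa hBb hneb γb
  set Zb : ℝ := ‖hexParafermionicObservable Λ (floorEdge ka mr) hexCriticalFugacity 0 (floorEdge kb m')‖
    with hZbdef
  have hZb0 : (Zb : ℂ) ≠ 0 := Complex.ofReal_ne_zero.2 hZb.ne'
  have hconj : (starRingEnd ℂ) (-exp (I * (5 / 8 : ℂ) * (γb.winding : ℂ))) =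
      -exp (-(I * (5 / 8 : ℂ) * (γb.winding : ℂ))) := by
    rw [map_neg, ← Complex.exp_conj]
    congr 2
    simp only [map_mul, Complex.conj_I, map_div₀, map_ofNat, Complex.conj_ofReal]
    ring
  have h1 : exp (-(I * (5 / 8 : ℂ) * (γb.winding : ℂ))) =
      exp (I * (3 / 8 : ℂ) * (γb.winding : ℂ)) * (exp ((γb.winding : ℂ) * I))⁻¹ := by
    rw [← Complex.exp_neg, ← Complex.exp_add]
    congr 1
    ring
  have hE0 : exp (I * (3 / 8 : ℂ) * (γb.winding : ℂ)) ≠ 0 := Complex.exp_ne_zero _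
  have hkey : (starRingEnd ℂ) (-exp (I * (5 / 8 : ℂ) * (γb.winding : ℂ))) *
      ((δ : ℂ) * (H s - H sb) /
        hexParafermionicObservable Λ (floorEdge ka mr) hexCriticalFugacity (5 / 8) (floorEdge kb m')) =
      -((δ : ℂ) * (H s - H sb) / (Zb : ℂ)) := by
    rw [hconj, hFb, h1, hW]
    field_simp
  rw [hkey, Complex.neg_re, Complex.div_ofReal_re, Complex.re_ofReal_mul, Complex.sub_re]

/-- **`HalfPlaneBounds` IS the root wedge**: `δ·(Re H s − Re H s_b) ≤ M·Z_b` gives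
`−M ≤ Re(conj ω · h_δ(s))` for `h_δ(s) = δ(H s − H s_b)/F(b)`, `ω = −e^{i(5/8)W_b}`. [folklore] -/
theorem rootFrame_wedge (hΛ : hexDomainSimplyConnected Λ) {ka mr kb m' : ℤ}
    (hUa : upFace ka mr ∈ Λ) (hBa : belowFace ka mr ∉ Λ) (hUb : upFace kb m' ∈ Λ)
    (hBb : belowFace kb m' ∉ Λ) (hneb : floorEdge kb m' ≠ floorEdge ka mr)
    (γb : HexMidEdgeSAW Λ (floorEdge ka mr) (floorEdge kb m')) {H : Site 2 → ℂ} {s sb : Site 2}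
    {δ M : ℝ}
    (hM : δ * ((H s).re - (H sb).re) ≤
      M * ‖hexParafermionicObservable Λ (floorEdge ka mr) hexCriticalFugacity 0 (floorEdge kb m')‖) :
    -M ≤ ((starRingEnd ℂ) (-exp (I * (5 / 8 : ℂ) * (γb.winding : ℂ))) *
        ((δ : ℂ) * (H s - H sb) /
          hexParafermionicObservable Λ (floorEdge ka mr) hexCriticalFugacity (5 / 8) (floorEdge kb m'))).re := by
  have hZb := (normaliser_observable hΛ hUa hBa hUb hBb hneb γb).2
  rw [rootFrame_re hΛ hUa hBa hUb hBb hneb γb H s sb δ, neg_le_neg_iff, div_le_iff₀ hZb]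
  exact hM

/-! ### Winding classes -/

/-- `e^{iW} = −1` forces `W = π + 2πj` for an integer `j`. [folklore] -/
theorem exists_winding_eq {W : ℝ} (hW : exp ((W : ℂ) * I) = -1) :
    ∃ j : ℤ, W = Real.pi + 2 * Real.pi * j := by
  have h1 : exp ((W : ℂ) * I - Real.pi * I) = 1 := by
    rw [Complex.exp_sub, hW, Complex.exp_pi_mul_I, neg_div_neg_eq, div_one]
  obtain ⟨n, hn⟩ := Complex.exp_eq_one_iff.1 h1
  refine ⟨n, ?_⟩
  have := congrArg Complex.im hn
  simp only [Complex.sub_im, Complex.mul_im, Complex.ofReal_re, Complex.I_im, Complex.ofReal_im,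
    Complex.I_re, mul_zero, add_zero, mul_one, Complex.intCast_re, Complex.intCast_im,
    Complex.mul_re, Complex.re_ofNat, Complex.im_ofNat, zero_mul, sub_zero] at this
  linarith

/-- Between floor darts the winding is `π + 2πj`. [folklore] -/
theorem exists_winding_floorDarts_eq {ka mr k m : ℤ} (hBa : belowFace ka mr ∉ Λ)
    (hB : belowFace k m ∉ Λ) (hne : floorEdge k m ≠ floorEdge ka mr)
    (γ : HexMidEdgeSAW Λ (floorEdge ka mr) (floorEdge k m)) :
    ∃ j : ℤ, γ.winding = Real.pi + 2 * Real.pi * j :=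
  exists_winding_eq (exp_winding_floorDarts hBa hB hne γ)

/-- Integers of the same class mod `8` differ by a multiple of `8` (real form). [folklore] -/
theorem exists_eq_sub_of_class {j j' : ℤ} (h : (j : ZMod 8) = (j' : ZMod 8)) :
    ∃ q : ℤ, (j : ℝ) = j' - 8 * q := by
  rw [ZMod.intCast_eq_intCast_iff_dvd_sub] at h
  obtain ⟨q, hq⟩ := h
  refine ⟨q, ?_⟩
  have h1 : (j' : ℤ) - j = 8 * q := by exact_mod_cast hq
  have h2 : (j : ℤ) = j' - 8 * q := by omega
  exact_mod_cast h2

/-- **The engine phase depends on the class `j mod 8` only**: if `j ≡ j' (mod 8)` then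
`e^{i(π/8 − (3/8)(π+2πj))} = e^{i(π/8 − (3/8)(π+2πj'))}`. [folklore] -/
theorem phase_eq_of_class {j j' : ℤ} (h : (j : ZMod 8) = (j' : ZMod 8)) :
    exp (((Real.pi / 8 - 3 / 8 * (Real.pi + 2 * Real.pi * j) : ℝ) : ℂ) * I) =
      exp (((Real.pi / 8 - 3 / 8 * (Real.pi + 2 * Real.pi * j') : ℝ) : ℂ) * I) := by
  obtain ⟨q, hj⟩ := exists_eq_sub_of_class h
  have e : ((Real.pi / 8 - 3 / 8 * (Real.pi + 2 * Real.pi * j) : ℝ) : ℂ) * I =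
      ((Real.pi / 8 - 3 / 8 * (Real.pi + 2 * Real.pi * j') : ℝ) : ℂ) * I +
        ((3 * q : ℤ) : ℂ) * (2 * Real.pi * I) := by
    rw [hj]; push_cast; ring
  rw [e, Complex.exp_add, Complex.exp_int_mul_two_pi_mul_I, mul_one]

/-- **The wedge direction depends on the class `j mod 8` only**: if `j ≡ j' (mod 8)` then
`−e^{i(5/8)(π+2πj)} = −e^{i(5/8)(π+2πj')}`. [folklore] -/
theorem omega_eq_of_class {j j' : ℤ} (h : (j : ZMod 8) = (j' : ZMod 8)) :
    -exp (I * (5 / 8 : ℂ) * ((Real.pi + 2 * Real.pi * j : ℝ) : ℂ)) =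
      -exp (I * (5 / 8 : ℂ) * ((Real.pi + 2 * Real.pi * j' : ℝ) : ℂ)) := by
  obtain ⟨q, hj⟩ := exists_eq_sub_of_class h
  have e : I * (5 / 8 : ℂ) * ((Real.pi + 2 * Real.pi * j : ℝ) : ℂ) =
      I * (5 / 8 : ℂ) * ((Real.pi + 2 * Real.pi * j' : ℝ) : ℂ) +
        ((-(5 * q) : ℤ) : ℂ) * (2 * Real.pi * I) := by
    rw [hj]; push_cast; ring
  rw [e, Complex.exp_add, Complex.exp_int_mul_two_pi_mul_I, mul_one]

/-- **The segment direction depends on the class mod 8 only**: if `j ≡ j' (mod 8)` then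
`e^{i(3/8)·2π j} = e^{i(3/8)·2π j'}` (segment phase `W₀ − W_b = 2π j`). [folklore] -/
theorem segmentPhase_eq_of_class {j j' : ℤ} (h : (j : ZMod 8) = (j' : ZMod 8)) :
    exp (I * (3 / 8 : ℂ) * ((2 * Real.pi * j : ℝ) : ℂ)) =
      exp (I * (3 / 8 : ℂ) * ((2 * Real.pi * j' : ℝ) : ℂ)) := by
  obtain ⟨q, hj⟩ := exists_eq_sub_of_class h
  have e : I * (3 / 8 : ℂ) * ((2 * Real.pi * j : ℝ) : ℂ) =
      I * (3 / 8 : ℂ) * ((2 * Real.pi * j' : ℝ) : ℂ) + ((-(3 * q) : ℤ) : ℂ) * (2 * Real.pi * I) := by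
    rw [hj]; push_cast; ring
  rw [e, Complex.exp_add, Complex.exp_int_mul_two_pi_mul_I, mul_one]

/-- **Registered helper `boundaryDataTransfer_flatSegmentFrame`** (crux stmt-CriticalPhenomena-14004,
line `pick-half-plane`, stub `stub_boundaryDataTransfer`, lattice input of (I4)): the flat segment
law in the `b`-frame, ∀-closed (`flatSegment_frame`). [folklore] -/
theorem boundaryDataTransfer_flatSegmentFrame : ∀ (Λ : Finset HexVertex), hexDomainSimplyConnected Λ → ∀ (ka mr m k₁ k₂ : ℤ), upFace ka mr ∈ Λ → belowFace ka mr ∉ Λ → (∀ k : ℤ, k₁ ≤ k → k ≤ k₂ → ((![k, m], 0) : HexVertex) ∈ Λ ∧ ((![k, m - 1], 1) : HexVertex) ∉ Λ ∧ (k < k₂ → ((![k, m], 1) : HexVertex) ∈ Λ)) → (∀ k : ℤ, k₁ ≤ k → k ≤ k₂ → floorEdge k m ≠ floorEdge ka mr) → ∀ (k₀ : ℤ), k₁ ≤ k₀ → k₀ ≤ k₂ → ∀ (γ₀ : HexMidEdgeSAW Λ (floorEdge ka mr) (floorEdge k₀ m)) (kb m' : ℤ), upFace kb m' ∈ Λ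 → belowFace kb m' ∉ Λ → floorEdge kb m' ≠ floorEdge ka mr → ∀ (γb : HexMidEdgeSAW Λ (floorEdge ka mr) (floorEdge kb m')) (H : Site 2 → ℂ), IsPotential Λ (floorEdge ka mr) H → ∀ (n : ℕ) (k : ℤ), k₁ ≤ k → k + n ≤ k₂ + 1 → (H ![k + n, m] - H ![k, m]) / hexParafermionicObservable Λ (floorEdge ka mr) hexCriticalFugacity (5 / 8) (floorEdge kb m') = -(Complex.I * Complex.exp (Complex.I * (3 / 8 : ℂ) * ((γ₀.winding - γb.winding : ℝ) : ℂ))) * ((Real.sqrt 3 / 6 * ∑ i ∈ Finset.range n, ‖hexParafermionicObservable Λ (floorEdge ka mr) hexCriticalFugacity 0 (floorEdge (k + i) m)‖ / ‖hexParafermionicObservable Λ (floorEdge ka mr) hexCriticalFugacity 0 (floorEdge kb m')‖ : ℝ) : ℂ) :=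
  fun _ hΛ _ _ _ _ _ hUa hBa hF hroot _ hk₀₁ hk₀₂ γ₀ _ _ hUb hBb hneb γb _ hH =>
    flatSegment_frame hΛ hUa hBa hF hroot hk₀₁ hk₀₂ γ₀ hUb hBb hneb γb hH

end Summit.CriticalPhenomena.SAWScalingLimit.Theorems.PickHalfPlane.BoundaryDataTransfer

end
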